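import Mathlib

/-!
# `QuadraticDigitPhases` (stmt-QuantumAdvantage-1391), line `Sketch` — stub `stub_rankTrunc` (truncation bound)

Pure `𝔽₂` linear algebra.  Write `c i j` for the coefficient of `X_i X_j` in `P` and, for a set of
rows `B' ⊆ ℕ` and a column bound `N'`, `M(B', N') = (c i j · [i ∈ B' ∧ j < N' ∧ dist i j > s])_{i,j<n}`.
The cut matrix at `c₀` is `Cut(c₀) = (c i j · [i < c₀ ≤ j])`, of rank `< R₀` for every `c₀`.
For an `s`-separated `B` we show
`rank M(B, n) ≤ rank M(B ∩ [0,N), N) + #(B ∩ [N,∞)) + R₀`.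

Proof.  Split the rows: `M(B, n) = M(B_lo, n) + M(B_hi, n)` with `B_lo = B ∩ [0,N)`,
`B_hi = B ∩ [N,∞)`; the second matrix has at most `#B_hi` nonzero rows (`rank_le_card_of_rows`).
Split the columns of `M(B_lo, n)`: the columns `< N` give `M(B_lo, N)`, the columns `≥ N` a matrix
`X`.  The rows `i ∈ B_lo` of `X` with `i + s < N` see every column `j ≥ N` at distance `> s`, so on
them `X` agrees with `Cut(N)`; i.e. `X = D * Cut(N) + Y` with `D` diagonal and `Y` supported on the
rows `i ∈ B ∩ [N-s, N)`, of which there is at most one by `s`-separation.  Hence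
`rank X ≤ (R₀ - 1) + 1` and everything is assembled with `rank (A + B) ≤ rank A + rank B`.
-/

set_option linter.dupNamespace false -- D-0017: single-problem summit ⇒ `QuantumAdvantage.QuantumAdvantage` by design

namespace Summit.QuantumAdvantage.QuantumAdvantage.Theorems.MobiusLadderQuadraticDigitPhasesStubRankTrunc

open Finset

/-- Subadditivity of the rank: `rank (A + B) ≤ rank A + rank B` (folklore). -/
private theorem rank_add_le {m k : Type*} [Fintype k] (A A' : Matrix m k (ZMod 2)) :
    (A + A').rank ≤ A.rank + A'.rank := by
  unfold Matrix.rank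
  rw [Matrix.mulVecLin_add]
  exact (Submodule.finrank_mono (LinearMap.range_add_le _ _)).trans
    (Submodule.finrank_add_le_finrank_add_finrank _ _)

/-- A matrix whose rows outside `R` vanish has rank `≤ #R` (folklore). -/
private theorem rank_le_card_of_rows {m k : Type*} [Fintype m] [Fintype k] [DecidableEq m]
    (A : Matrix m k (ZMod 2)) (R : Finset m) (hA : ∀ i ∉ R, ∀ j, A i j = 0) : A.rank ≤ R.card := by
  have hE : A = Matrix.diagonal (fun i => if i ∈ R then (1 : ZMod 2) else 0) * A := by
    ext i j
    rw [Matrix.diagonal_mul]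
    by_cases hi : i ∈ R
    · simp [hi]
    · simp [hi, hA i hi j]
  rw [hE]
  refine (Matrix.rank_mul_le_left _ _).trans ?_
  rw [Matrix.rank_diagonal]
  refine le_of_eq ?_
  rw [Fintype.card_subtype]
  congr 1
  ext i
  simp

/-- The truncation bound for an arbitrary coefficient pattern `c` (the statement of `stub_rankTrunc`
with `c i j` in place of the coefficient of `X_i X_j`). -/
private theorem rank_trunc_aux (n : ℕ) (c : Fin n → Fin n → ZMod 2) (s R₀ : ℕ) (B : Finset ℕ) (N : ℕ)
    (hcut : ∀ c₀ : ℕ, (Matrix.of fun (i j : Fin n) =>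
      if (i : ℕ) < c₀ ∧ c₀ ≤ (j : ℕ) then c i j else 0).rank < R₀)
    (hsep : ∀ b ∈ B, ∀ b' ∈ B, b < b' → s < b' - b) :
    (Matrix.of fun (i j : Fin n) => if (i : ℕ) ∈ B ∧ (j : ℕ) < n ∧ s < Nat.dist (i : ℕ) (j : ℕ) then
        c i j else 0).rank ≤
      (Matrix.of fun (i j : Fin n) => if (i : ℕ) ∈ (B.filter (fun b => b < N)) ∧ (j : ℕ) < N ∧
          s < Nat.dist (i : ℕ) (j : ℕ) then c i j else 0).rank +
        (B.filter (fun b => N ≤ b)).card + R₀ := by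
  -- (1) split the rows of `M(B, n)` into `B_lo` and `B_hi`
  have h1 : (Matrix.of fun (i j : Fin n) => if (i : ℕ) ∈ B ∧ (j : ℕ) < n ∧
        s < Nat.dist (i : ℕ) (j : ℕ) then c i j else 0) =
      (Matrix.of fun (i j : Fin n) => if (i : ℕ) ∈ (B.filter (fun b => b < N)) ∧ (j : ℕ) < n ∧
          s < Nat.dist (i : ℕ) (j : ℕ) then c i j else 0) +
        (Matrix.of fun (i j : Fin n) => if (i : ℕ) ∈ (B.filter (fun b => N ≤ b)) ∧ (j : ℕ) < n ∧
          s < Nat.dist (i : ℕ) (j : ℕ) then c i j else 0) := by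
    ext i j
    simp only [Matrix.add_apply, Matrix.of_apply, Finset.mem_filter]
    by_cases hB : (i : ℕ) ∈ B
    · by_cases hiN : (i : ℕ) < N
      · have hiN' : ¬ N ≤ (i : ℕ) := Nat.not_le.mpr hiN
        simp [hB, hiN, hiN']
      · have hiN' : N ≤ (i : ℕ) := Nat.le_of_not_lt hiN
        simp [hB, hiN, hiN']
    · simp [hB]
  -- rank of the `B_hi` part: at most `#B_hi` nonzero rows
  have hhi : (Matrix.of fun (i j : Fin n) => if (i : ℕ) ∈ (B.filter (fun b => N ≤ b)) ∧ (j : ℕ) < n ∧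
      s < Nat.dist (i : ℕ) (j : ℕ) then c i j else 0).rank ≤ (B.filter (fun b => N ≤ b)).card := by
    refine (rank_le_card_of_rows _
      (Finset.univ.filter (fun i : Fin n => (i : ℕ) ∈ B.filter (fun b => N ≤ b))) ?_).trans ?_
    · intro i hi j
      simp only [Finset.mem_filter, Finset.mem_univ, true_and] at hi
      simp only [Matrix.of_apply]
      rw [if_neg (fun h => hi (Finset.mem_filter.mp h.1))]
    · refine Finset.card_le_card_of_injOn (fun i : Fin n => (i : ℕ)) ?_ ?_
      · intro i hi
        simpa using hi
      · intro i _ i' _ h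
        exact Fin.ext h
  -- (2) split the columns of `M(B_lo, n)` at `N`
  have h2 : (Matrix.of fun (i j : Fin n) => if (i : ℕ) ∈ (B.filter (fun b => b < N)) ∧ (j : ℕ) < n ∧
        s < Nat.dist (i : ℕ) (j : ℕ) then c i j else 0) =
      (Matrix.of fun (i j : Fin n) => if (i : ℕ) ∈ (B.filter (fun b => b < N)) ∧ (j : ℕ) < N ∧
          s < Nat.dist (i : ℕ) (j : ℕ) then c i j else 0) +
        (Matrix.of fun (i j : Fin n) => if (i : ℕ) ∈ (B.filter (fun b => b < N)) ∧ N ≤ (j : ℕ) ∧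
          s < Nat.dist (i : ℕ) (j : ℕ) then c i j else 0) := by
    ext i j
    simp only [Matrix.add_apply, Matrix.of_apply]
    by_cases hB : (i : ℕ) ∈ B.filter (fun b => b < N)
    · by_cases hd : s < Nat.dist (i : ℕ) (j : ℕ)
      · by_cases hjN : (j : ℕ) < N
        · have hjN' : ¬ N ≤ (j : ℕ) := Nat.not_le.mpr hjN
          simp [hB, hd, hjN, hjN']
        · have hjN' : N ≤ (j : ℕ) := Nat.le_of_not_lt hjN
          simp [hB, hd, hjN, hjN']
      · simp [hd]
    · simp [hB]
  -- (3) the removed columns: `X = D * Cut(N) + Y`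
  have h3 : (Matrix.of fun (i j : Fin n) => if (i : ℕ) ∈ (B.filter (fun b => b < N)) ∧ N ≤ (j : ℕ) ∧
        s < Nat.dist (i : ℕ) (j : ℕ) then c i j else 0) =
      Matrix.diagonal (fun i : Fin n => if (i : ℕ) ∈ B ∧ (i : ℕ) + s < N then (1 : ZMod 2) else 0) *
          (Matrix.of fun (i j : Fin n) => if (i : ℕ) < N ∧ N ≤ (j : ℕ) then c i j else 0) +
        (Matrix.of fun (i j : Fin n) => if ((i : ℕ) ∈ B ∧ (i : ℕ) < N ∧ N ≤ (i : ℕ) + s) ∧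
          N ≤ (j : ℕ) ∧ s < Nat.dist (i : ℕ) (j : ℕ) then c i j else 0) := by
    ext i j
    rw [Matrix.add_apply, Matrix.diagonal_mul]
    simp only [Matrix.of_apply, Finset.mem_filter]
    by_cases hB : (i : ℕ) ∈ B
    · by_cases his : (i : ℕ) + s < N
      · have hiN : (i : ℕ) < N := by omega
        have his' : ¬ N ≤ (i : ℕ) + s := Nat.not_le.mpr his
        by_cases hjN : N ≤ (j : ℕ)
        · have hd : s < Nat.dist (i : ℕ) (j : ℕ) := by
            rw [Nat.dist_eq_sub_of_le (by omega)]
            omega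
          simp [hB, his, hiN, his', hjN, hd]
        · simp [hB, his, hiN, his', hjN]
      · have his' : N ≤ (i : ℕ) + s := Nat.le_of_not_lt his
        simp [hB, his, his']
    · simp [hB]
  -- `Y` has at most one nonzero row, by `s`-separation
  have hY : (Matrix.of fun (i j : Fin n) => if ((i : ℕ) ∈ B ∧ (i : ℕ) < N ∧ N ≤ (i : ℕ) + s) ∧
      N ≤ (j : ℕ) ∧ s < Nat.dist (i : ℕ) (j : ℕ) then c i j else 0).rank ≤ 1 := by
    refine (rank_le_card_of_rows _
      (Finset.univ.filter (fun i : Fin n => (i : ℕ) ∈ B ∧ (i : ℕ) < N ∧ N ≤ (i : ℕ) + s)) ?_).trans ?_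
    · intro i hi j
      simp only [Finset.mem_filter, Finset.mem_univ, true_and] at hi
      simp only [Matrix.of_apply]
      rw [if_neg (fun h => hi h.1)]
    · refine Finset.card_le_one.mpr ?_
      intro a ha b hb
      simp only [Finset.mem_filter, Finset.mem_univ, true_and] at ha hb
      apply Fin.ext
      rcases lt_trichotomy (a : ℕ) (b : ℕ) with hab | hab | hab
      · have := hsep _ ha.1 _ hb.1 hab
        omega
      · exact hab
      · have := hsep _ hb.1 _ ha.1 hab
        omega
  -- the cut matrix at `N`
  have hC := hcut N
  have hDC : (Matrix.diagonal (fun i : Fin n => if (i : ℕ) ∈ B ∧ (i : ℕ) + s < N then (1 : ZMod 2) else 0) *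
      (Matrix.of fun (i j : Fin n) => if (i : ℕ) < N ∧ N ≤ (j : ℕ) then c i j else 0)).rank ≤
      (Matrix.of fun (i j : Fin n) => if (i : ℕ) < N ∧ N ≤ (j : ℕ) then c i j else 0).rank :=
    Matrix.rank_mul_le_right _ _
  have hX := (rank_add_le _ _).trans (add_le_add hDC hY)
  rw [← h3] at hX
  have hlo := rank_add_le
    (Matrix.of fun (i j : Fin n) => if (i : ℕ) ∈ (B.filter (fun b => b < N)) ∧ (j : ℕ) < N ∧
      s < Nat.dist (i : ℕ) (j : ℕ) then c i j else 0)
    (Matrix.of fun (i j : Fin n) => if (i : ℕ) ∈ (B.filter (fun b => b < N)) ∧ N ≤ (j : ℕ) ∧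
      s < Nat.dist (i : ℕ) (j : ℕ) then c i j else 0)
  rw [← h2] at hlo
  have htot := rank_add_le
    (Matrix.of fun (i j : Fin n) => if (i : ℕ) ∈ (B.filter (fun b => b < N)) ∧ (j : ℕ) < n ∧
      s < Nat.dist (i : ℕ) (j : ℕ) then c i j else 0)
    (Matrix.of fun (i j : Fin n) => if (i : ℕ) ∈ (B.filter (fun b => N ≤ b)) ∧ (j : ℕ) < n ∧
      s < Nat.dist (i : ℕ) (j : ℕ) then c i j else 0)
  rw [← h1] at htot
  omega

/-- STUB `stub_rankTrunc` (structure): truncating the columns to `[0,N)` and the rows to `B ∩ [0,N)`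
costs at most `#(B ∩ [N,n)) + R₀`: rows `≥ N` cost one each; for the rows `< N` the removed columns
`≥ N` form (up to the single row of the `s`-separated `B` inside `[N-s, N)`) a row restriction of the
cut matrix at `N`, of rank `< R₀`. -/
theorem stub_rankTrunc :
    ∀ (n : ℕ) (P : MvPolynomial (Fin n) (ZMod 2)) (s R₀ : ℕ) (B : Finset ℕ) (N : ℕ), N ≤ n → (∀ c : ℕ, (Matrix.of fun (i j : Fin n) => if (i : ℕ) < c ∧ c ≤ (j : ℕ) then MvPolynomial.coeff (Finsupp.single i 1 + Finsupp.single j 1) P else 0).rank < R₀) →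
      (∀ b ∈ B, ∀ b' ∈ B, b < b' → s < b' - b) →
      (Matrix.of fun (i j : Fin n) => if (i : ℕ) ∈ B ∧ (j : ℕ) < n ∧ s < Nat.dist (i : ℕ) (j : ℕ) then MvPolynomial.coeff (Finsupp.single i 1 + Finsupp.single j 1) P else 0).rank ≤
        (Matrix.of fun (i j : Fin n) => if (i : ℕ) ∈ (B.filter (fun b => b < N)) ∧ (j : ℕ) < N ∧ s < Nat.dist (i : ℕ) (j : ℕ) then MvPolynomial.coeff (Finsupp.single i 1 + Finsupp.single j 1) P else 0).rank + (B.filter (fun b => N ≤ b)).card + R₀ :=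
  fun n P s R₀ B N _ hcut hsep =>
    rank_trunc_aux n (fun i j => MvPolynomial.coeff (Finsupp.single i 1 + Finsupp.single j 1) P)
      s R₀ B N hcut hsep

end Summit.QuantumAdvantage.QuantumAdvantage.Theorems.MobiusLadderQuadraticDigitPhasesStubRankTrunc
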